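import Mathlib.Analysis.Calculus.FDeriv.Measurable
import Literature.Geometry.Lorentzian.ChartCalculus
import Literature.Barriers.FinalStateConjecture.TrappingDerivativeLossProofs
import HarnessLib

/-!
# Sbierski's Kerr trapping theorem: the two inputs of the localised solutions, and Thm. 2.1's
# approximation argument proved
(second companion file of `Literature/Barriers/FinalStateConjecture/TrappingDerivativeLoss.lean`;
family `gr`, summit `FinalStateConjecture`; namespace `Literature.Barriers.FinalStateConjecture`)

`TrappingDerivativeLoss.lean` vendors Sbierski's obstruction to derivative-loss-free local energy
decay on the Kerr exterior `0 ≤ a ≤ M`, `M > 0` (`SbierskiTrappingObstruction`, the data-localised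
reading of Anal. PDE 8 (2015), Thm. 7.4; `SbierskiKerrTrappingLED`, the print-literal form), and
`TrappingDerivativeLossProofs.lean` proves both from the single named fact
`SbierskiKerrLocalisedSolutions` (Thm. 5.1 with §7A, rendered: genuine solutions with data in the
ball `{‖y‖ ≤ R}`, initial coordinate energy `≤ C`, local coordinate energy `≥ c > 0` up to any
prescribed time `T`). That fact still bundles two inputs of a very different nature, which the
printed proof of Thm. 2.1 (arXiv: Thm. 1, §2.1) keeps apart:

1. **(A) the Cauchy problem and the energy estimate for `□_g` on the Kerr exterior** — "we make
   use of the fact that the Lorentzian manifold `(M, g)` is globally hyperbolic and thus allows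
   for a well-posed initial value problem for the wave equation. Moreover, [...] we have an energy
   estimate of the form `∫_{Σ_τ} J^N(u)·n_{Σ_τ} ≤ C(T, N, {Σ_τ}) (∫_{Σ₀} J^N(u)·n_{Σ₀} +
   ‖□u‖²_{L²(R_{[0,T]})})` for all `0 ≤ τ ≤ T` at our disposal (see for example [Taylor], chapter
   2.8). Thus, we obtain `E^N_τ(v_λ − ũ_λ) ≤ C(T, N, Σ_τ) · ‖□ũ_λ‖²_{L²(R_{[0,T]})}`" (Sbierski,
   proof of Thm. 2.1) — a textbook theorem about linear waves (Bär–Ginoux–Pfäffle 2007, Ch. 3,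
   Sect. 2, Thm. 2.9 of the arXiv version: smooth compactly supported data on a Cauchy
   hypersurface of a globally hyperbolic manifold have a unique smooth solution), vendored here as
   the named fact `KerrWaveCauchyEnergyEstimate`;
2. **(B) the Gaussian beams along the trapped null geodesics of Kerr** — approximate solutions
   `ũ_λ = u_λ / √E₀(u_λ)`, `u_λ = a_𝒩 e^{iλφ}`, with `‖□u_λ‖_{L²(R_{[0,T]})} ≤ C(T)`,
   `E₀(u_λ) → ∞`, `supp u_λ ⊆ 𝒩` (the three conditions of the proof of Thm. 2.1, established in
   §3 = arXiv §2.2), whose energy is characterised by the energy of the geodesic,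
   `|E^N_τ(ũ_{λ,𝒩₀}) − (−g(N, γ̇)|_{Im γ ∩ Σ_τ})| < μ` for `0 ≤ τ ≤ T`, `λ ≥ λ₀` (the main theorem
   of Part I, arXiv Thm. 7, §2.3 = journal §4), taken along a trapped null geodesic `γ_{r₀}` of
   the Kerr exterior, on which `−g(N, γ̇) = ṫ*` "is bounded away from zero and infinity" (§7A =
   arXiv §3.2.1) — vendored as the named fact `SbierskiKerrGaussianBeams`.

From (A) and (B) this file **proves** `SbierskiKerrLocalisedSolutions`
(`SbierskiKerrLocalisedSolutions.of_inputs`), by exactly the printed argument: solve the Cauchy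
problem with the beam's data, bound the energy of the difference by `K(T) ‖□ũ‖² ≤ K(T) ε`, and
split the local energy of the beam between the solution and the difference (here with the
elementary `E(u) ≤ 2E(ψ) + 2E(ψ − u)` in place of the triangle inequality for `√E`, which only
changes constants: `c = c_B / 4`). Hence `SbierskiTrappingObstruction.of_inputs` and
`SbierskiKerrTrappingLED.of_inputs`. The discharge of `SbierskiTrappingObstruction` is thereby
reduced to the two leaves (A), (B), recorded with the printed statements they render. Status
(2026-08-15): (A) is now **derived** from the canonical Cauchy-problem fact
`KerrSchild.waveCauchyProblem` — the energy estimate itself being proved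
(`KerrSchild.Background.lintegral_energy_estimate`, `KerrSchildEnergyEstimate.lean`; uniform
constant via `KerrSurgeryBackgroundBounds.lean`) — in `TrappingDerivativeLossEnergy.lean`
(`KerrWaveCauchyEnergyEstimate.of_waveCauchyProblem`), and (B) is derived from the literal beam fact
`SbierskiKerrTrappedGeodesicBeams` in `TrappingDerivativeLossBeams.lean`
(`SbierskiKerrGaussianBeams.of_trappedGeodesicBeams`); the remaining trust base of the barrier is
those two facts (existence theory for variable-coefficient wave equations; Gaussian beams).

## Rendering (conventions of the parent files)

Waves are real functions on the ingoing Kerr–Schild exterior chart `Kerr.exterior M a = {r > r₊}`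
(`↥(Kerr.exterior M a)`, model `𝓘(ℝ, E4)`), `□_g` is `PseudoRiemannianMetric.dalembertian` of
`Kerr.smoothMetric M a r₊` under `[Kerr.Facts] [Kerr.SliceFacts]`, energies are the coordinate
energies `sliceEnergy` / `localSliceEnergy` of `WeightedNorms.lean` through the leaves `{t* = τ}`,
comparable on `{r > r₊} ∩ {‖y‖ ≤ R}` and on `{r > r₊}` to the `J^N`-fluxes, `N = −(dt*)♯ =
Kerr.timeVector`, with constants depending on `(M, a, R)` only (parent file, "Energies"; the
constants are absorbed into `K`, `c`, `C`). The space-time norm `‖□u‖²_{L²(R_{[0,T]})}` is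
`slabSqNorm`: the integral of `(□u)²` over `{0 ≤ t* ≤ T} ∩ {r > r₊}` against Lebesgue measure
`d⁴x` of the chart, which **is** the metric volume `vol_g` since `det g = −1` for a Kerr–Schild
metric `η + 2H ℓ ⊗ ℓ`, `ℓ` null. Sbierski's solutions live on `D(Σ₀) ⊇ {t* ≥ 0} ∩ {r > r₊}`
(`Σ₀ = {t* = 0} ∩ {r > r₊}`; the exterior future lies in `D⁺(Σ₀)` because the chart is ingoing,
parent file "Solutions"), an open neighbourhood of `{t* ≥ 0} ∩ {r > r₊}` in the chart; as in the
parent files a solution is recorded as a `C^∞` function on the whole chart solving `□_g ψ = 0` on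
`{t* > 0}` (cut `v` off smoothly inside `D(Σ₀) ∩ {t* < 0}`), which is the weaker existence claim.

## References

* J. Sbierski, *Characterisation of the energy of Gaussian beams on Lorentzian manifolds: with
  applications to black hole spacetimes*, Anal. PDE 8 (2015) 1379–1420 (arXiv:1311.2477v2, held):
  Thm. 2.1 and its proof with the three conditions and the energy estimate (arXiv Thm. 1, §2.1,
  p. 9), Def. of Gaussian beams `u_{λ,𝒩}`, `ũ_{λ,𝒩}` (arXiv §2.2, p. 15), the main theorem of
  Part I on the energy of Gaussian beams (arXiv Thm. 7, §2.3, p. 15; journal §4), Thm. 5.1 (arXiv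
  Thm. 8, p. 17), §7A (arXiv §3.2.1, pp. 26–27: `t* = v₊ − r`, `N = −(dt*)♯`, trapped `γ_{r₀}`,
  `r₀ ∈ [r_δ, r_ρ]`, `−(N, γ̇) = ṫ` bounded away from `0` and `∞`), Thm. 7.4 (arXiv Thm. 14).
* C. Bär, N. Ginoux, F. Pfäffle, *Wave equations on Lorentzian manifolds and quantization*, EMS
  2007 (arXiv:0806.1036, held), Ch. 3, Sect. 2, Thm. 2.9 of the arXiv version (Cauchy problem on
  globally hyperbolic manifolds: existence, uniqueness, `supp u ⊆ J(K)`).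
* M. E. Taylor, *Partial Differential Equations I*, Springer 2011, Ch. 2 §8 (the energy estimate,
  as cited by Sbierski, loc. cit.).
-/

noncomputable section

open Set Filter Topology MeasureTheory
open scoped Manifold ContDiff ENNReal

namespace Literature.Barriers.FinalStateConjecture

open Literature.Geometry.Lorentzian

/-! ### The space-time `L²` norm over a slab, and calculus of representatives -/

section General

variable (U : TopologicalSpace.Opens E4)

/-- The **squared space-time `L²` norm of `F : U → ℝ` over the slab `R_{[0,T]} = {0 ≤ t* ≤ T}`**:
`∫_{x ∈ U, 0 ≤ x⁰ ≤ T} F(x)² d⁴x ∈ [0, ∞]` (Lebesgue measure of the chart `E4`; the extension of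
`F` by zero is integrated against the indicator of the slab of `U`). For `U` a Kerr–Schild chart
domain `d⁴x = vol_g` (`det g = −1`), so with `F = □_g u` this is Sbierski's
`‖□u‖²_{L²(R_{[0,T]})}` (Anal. PDE 8 (2015), proof of Thm. 2.1, first condition on the beams).
[cite: Sbierski2015, §2 proof of Thm. 2.1] -/
def slabSqNorm (F : U → ℝ) (T : ℝ) : ℝ≥0∞ :=
  ∫⁻ x : E4, Set.indicator {x : E4 | x ∈ (U : Set E4) ∧ 0 ≤ x 0 ∧ x 0 ≤ T}
    (fun x ↦ ENNReal.ofReal (Function.extend Subtype.val F (0 : E4 → ℝ) x ^ 2)) x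

/-- The slab norm is monotone in the height of the slab. [folklore] -/
theorem slabSqNorm_mono (F : U → ℝ) {T T' : ℝ} (h : T ≤ T') :
    slabSqNorm U F T ≤ slabSqNorm U F T' := by
  have hsub : {x : E4 | x ∈ (U : Set E4) ∧ 0 ≤ x 0 ∧ x 0 ≤ T} ⊆
      {x : E4 | x ∈ (U : Set E4) ∧ 0 ≤ x 0 ∧ x 0 ≤ T'} :=
    fun x hx ↦ ⟨hx.1, hx.2.1, hx.2.2.trans h⟩
  exact lintegral_mono fun x ↦ Set.indicator_le_indicator_of_subset hsub (fun _ ↦ zero_le) x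

variable {U}

/-- The representative `Function.extend Subtype.val f 0 : E4 → ℝ` of `f : U → ℝ` agrees with `f`
on `U`. [folklore] -/
theorem extend_val_apply (f : U → ℝ) (y : U) :
    Function.extend Subtype.val f (0 : E4 → ℝ) y = f y :=
  Subtype.val_injective.extend_apply _ _ y

/-- The representative of the zero function is zero. [folklore] -/
theorem extend_val_zero : Function.extend Subtype.val (fun _ : U ↦ (0 : ℝ)) (0 : E4 → ℝ) = 0 := by
  funext y
  by_cases hy : ∃ z : U, (z : E4) = y
  · obtain ⟨z, rfl⟩ := hy
    exact extend_val_apply _ z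
  · exact Function.extend_apply' _ _ _ hy

variable (U) in
/-- The slab norm of the zero function vanishes (sanity unfolding of `slabSqNorm`). [folklore] -/
@[simp]
theorem slabSqNorm_zero (T : ℝ) : slabSqNorm U (fun _ ↦ 0) T = 0 := by
  simp [slabSqNorm, extend_val_zero]

/-- The representative of a difference is the difference of the representatives (both sides
vanish off `U`). [folklore] -/
theorem extend_val_sub (f g : U → ℝ) :
    Function.extend Subtype.val (f - g) (0 : E4 → ℝ) =
      Function.extend Subtype.val f (0 : E4 → ℝ) - Function.extend Subtype.val g (0 : E4 → ℝ) := by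
  funext y
  by_cases hy : ∃ z : U, (z : E4) = y
  · obtain ⟨z, rfl⟩ := hy
    simp only [Pi.sub_apply, extend_val_apply]
  · simp only [Pi.sub_apply, Function.extend_apply' _ _ _ hy, Pi.zero_apply, sub_zero]

/-- The representative of a `C^n` function on the open set `U` (`n ≠ 0`) is differentiable at the
points of `U` (`OpensChart.contMDiffAt_iff`). [folklore] -/
theorem differentiableAt_extend_val {f : U → ℝ} {n : ℕ∞ω} (hn : n ≠ 0)
    (hf : ContMDiff 𝓘(ℝ, E4) 𝓘(ℝ, ℝ) n f) (x : U) :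
    DifferentiableAt ℝ (Function.extend Subtype.val f (0 : E4 → ℝ)) x :=
  ((OpensChart.contMDiffAt_iff x f _ fun y ↦ (extend_val_apply f y).symm).mp
    (hf x)).differentiableAt hn

/-- **The Fréchet derivative of the representative is the manifold derivative**
(`OpensChart.mfderiv_eq`), for `C^n` functions on the open set `U`, `n ≠ 0`. [folklore] -/
theorem fderiv_extend_val_eq_mfderiv {f : U → ℝ} {n : ℕ∞ω} (hn : n ≠ 0)
    (hf : ContMDiff 𝓘(ℝ, E4) 𝓘(ℝ, ℝ) n f) (x : U) :
    fderiv ℝ (Function.extend Subtype.val f (0 : E4 → ℝ)) x = mfderiv 𝓘(ℝ, E4) 𝓘(ℝ, ℝ) f x :=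
  (OpensChart.mfderiv_eq x f _ (fun y ↦ (extend_val_apply f y).symm)
    (differentiableAt_extend_val hn hf x)).symm

/-- The derivative of the representative of `f − g` at a point of `U` is the difference of the
derivatives. [folklore] -/
theorem fderiv_extend_val_sub {f g : U → ℝ} {n : ℕ∞ω} (hn : n ≠ 0)
    (hf : ContMDiff 𝓘(ℝ, E4) 𝓘(ℝ, ℝ) n f) (hg : ContMDiff 𝓘(ℝ, E4) 𝓘(ℝ, ℝ) n g) (x : U) :
    fderiv ℝ (Function.extend Subtype.val (f - g) (0 : E4 → ℝ)) x =
      fderiv ℝ (Function.extend Subtype.val f (0 : E4 → ℝ)) x -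
        fderiv ℝ (Function.extend Subtype.val g (0 : E4 → ℝ)) x := by
  rw [extend_val_sub, fderiv_sub (differentiableAt_extend_val hn hf x)
    (differentiableAt_extend_val hn hg x)]

/-- **The coordinate energy density depends only on the differential**: `C^n` functions
(`n ≠ 0`) with the same manifold derivative at a point of `U` have the same coordinate energy
density `∑_μ (∂_μ ·)²` there. [folklore] -/
theorem coordEnergyDensity_congr_of_mfderiv_eq {f g : U → ℝ} {n : ℕ∞ω} (hn : n ≠ 0)
    (hf : ContMDiff 𝓘(ℝ, E4) 𝓘(ℝ, ℝ) n f) (hg : ContMDiff 𝓘(ℝ, E4) 𝓘(ℝ, ℝ) n g) (x : U)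
    (h : mfderiv 𝓘(ℝ, E4) 𝓘(ℝ, ℝ) f x = mfderiv 𝓘(ℝ, E4) 𝓘(ℝ, ℝ) g x) :
    coordEnergyDensity U f x = coordEnergyDensity U g x := by
  unfold coordEnergyDensity
  rw [fderiv_extend_val_eq_mfderiv hn hf x, fderiv_extend_val_eq_mfderiv hn hg x, h]

/-- **Quasi-triangle inequality for the coordinate energy density**: at a point of `U`,
`∑_μ (∂_μ g)² ≤ 2 ∑_μ (∂_μ f)² + 2 ∑_μ (∂_μ (f − g))²` (componentwise `b² ≤ 2a² + 2(a − b)²`).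
[folklore] -/
theorem coordEnergyDensity_le_two_mul_add {f g : U → ℝ} {n : ℕ∞ω} (hn : n ≠ 0)
    (hf : ContMDiff 𝓘(ℝ, E4) 𝓘(ℝ, ℝ) n f) (hg : ContMDiff 𝓘(ℝ, E4) 𝓘(ℝ, ℝ) n g) (x : U) :
    coordEnergyDensity U g x ≤
      2 * coordEnergyDensity U f x + 2 * coordEnergyDensity U (f - g) x := by
  unfold coordEnergyDensity
  rw [fderiv_extend_val_sub hn hf hg x, Finset.mul_sum, Finset.mul_sum, ← Finset.sum_add_distrib]
  refine Finset.sum_le_sum fun μ _ ↦ ?_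
  rw [sub_apply]
  nlinarith [sq_nonneg (2 * fderiv ℝ (Function.extend Subtype.val f (0 : E4 → ℝ)) x
      (EuclideanSpace.single μ (1 : ℝ)) -
    fderiv ℝ (Function.extend Subtype.val g (0 : E4 → ℝ)) x (EuclideanSpace.single μ (1 : ℝ)))]

variable (U)

/-- The integrand `y ↦ 𝟙_{(τ, y) ∈ U} ∑_μ (∂_μ f)²(τ, y)` of the coordinate energies through the
leaf `{t* = τ}` is Borel measurable, for *every* `f` (the derivative of an arbitrary function is
measurable, `measurable_fderiv_apply_const`). [folklore] -/
theorem measurable_sliceIntegrand (f : U → ℝ) (τ : ℝ) :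
    Measurable fun y : E3 ↦ Set.indicator {y : E3 | E4.ofTimeSpace τ y ∈ U}
      (fun y ↦ ENNReal.ofReal (coordEnergyDensity U f (E4.ofTimeSpace τ y))) y := by
  refine Measurable.indicator ?_ (U.isOpen.preimage (E4.continuous_ofTimeSpace τ)).measurableSet
  refine ENNReal.measurable_ofReal.comp ?_
  unfold coordEnergyDensity
  refine Finset.measurable_sum _ fun μ _ ↦ Measurable.pow_const ?_ _
  exact (measurable_fderiv_apply_const ℝ (Function.extend Subtype.val f (0 : E4 → ℝ))
    (EuclideanSpace.single μ (1 : ℝ))).comp (E4.continuous_ofTimeSpace τ).measurable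

variable {U}

/-- **Solutions with the same Cauchy data on a leaf have the same energy through it**: if two
`C^n` functions (`n ≠ 0`) on `U` have the same differential at every point of `U ∩ {t* = τ}`,
their coordinate energies through `{t* = τ}` coincide. [folklore] -/
theorem sliceEnergy_congr_of_mfderiv_eq {f g : U → ℝ} {n : ℕ∞ω} (hn : n ≠ 0)
    (hf : ContMDiff 𝓘(ℝ, E4) 𝓘(ℝ, ℝ) n f) (hg : ContMDiff 𝓘(ℝ, E4) 𝓘(ℝ, ℝ) n g) (τ : ℝ)
    (h : ∀ x : U, (x : E4) 0 = τ →
      mfderiv 𝓘(ℝ, E4) 𝓘(ℝ, ℝ) f x = mfderiv 𝓘(ℝ, E4) 𝓘(ℝ, ℝ) g x) :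
    sliceEnergy U f τ = sliceEnergy U g τ := by
  unfold sliceEnergy
  refine lintegral_congr fun y ↦ ?_
  by_cases hy : E4.ofTimeSpace τ y ∈ U
  · rw [Set.indicator_of_mem (show y ∈ {y : E3 | E4.ofTimeSpace τ y ∈ U} from hy),
      Set.indicator_of_mem (show y ∈ {y : E3 | E4.ofTimeSpace τ y ∈ U} from hy)]
    exact congrArg ENNReal.ofReal (coordEnergyDensity_congr_of_mfderiv_eq hn hf hg ⟨_, hy⟩
      (h ⟨_, hy⟩ (E4.ofTimeSpace_apply_zero τ y)))
  · rw [Set.indicator_of_notMem (show y ∉ {y : E3 | E4.ofTimeSpace τ y ∈ U} from hy),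
      Set.indicator_of_notMem (show y ∉ {y : E3 | E4.ofTimeSpace τ y ∈ U} from hy)]

/-- **Quasi-triangle inequality for the local energy**: for `C^n` functions (`n ≠ 0`) on `U`,
`E_loc(g; τ, R) ≤ 2 E_loc(f; τ, R) + 2 E_loc(f − g; τ, R)` (integrate
`coordEnergyDensity_le_two_mul_add` over the ball). This replaces "the triangle inequality for
the square root of the `N`-energy" of Sbierski's proof of Thm. 5.1 (Anal. PDE 8 (2015)) at the
cost of constants. [folklore] -/
theorem localSliceEnergy_le_two_mul_add {f g : U → ℝ} {n : ℕ∞ω} (hn : n ≠ 0)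
    (hf : ContMDiff 𝓘(ℝ, E4) 𝓘(ℝ, ℝ) n f) (hg : ContMDiff 𝓘(ℝ, E4) 𝓘(ℝ, ℝ) n g) (τ R : ℝ) :
    localSliceEnergy U g τ R ≤
      2 * localSliceEnergy U f τ R + 2 * localSliceEnergy U (f - g) τ R := by
  unfold localSliceEnergy
  calc ∫⁻ y in Metric.closedBall (0 : E3) R, {y : E3 | E4.ofTimeSpace τ y ∈ U}.indicator
          (fun y ↦ ENNReal.ofReal (coordEnergyDensity U g (E4.ofTimeSpace τ y))) y
      ≤ ∫⁻ y in Metric.closedBall (0 : E3) R,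
          (2 * {y : E3 | E4.ofTimeSpace τ y ∈ U}.indicator
              (fun y ↦ ENNReal.ofReal (coordEnergyDensity U f (E4.ofTimeSpace τ y))) y +
            2 * {y : E3 | E4.ofTimeSpace τ y ∈ U}.indicator
              (fun y ↦ ENNReal.ofReal (coordEnergyDensity U (f - g) (E4.ofTimeSpace τ y))) y) := by
        refine lintegral_mono fun y ↦ ?_
        by_cases hy : E4.ofTimeSpace τ y ∈ U
        · have hyS : y ∈ {y : E3 | E4.ofTimeSpace τ y ∈ U} := hy
          rw [Set.indicator_of_mem hyS, Set.indicator_of_mem hyS, Set.indicator_of_mem hyS]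
          have hle := coordEnergyDensity_le_two_mul_add hn hf hg ⟨_, hy⟩
          have h0f := coordEnergyDensity_nonneg U f (E4.ofTimeSpace τ y)
          have h0w := coordEnergyDensity_nonneg U (f - g) (E4.ofTimeSpace τ y)
          calc ENNReal.ofReal (coordEnergyDensity U g (E4.ofTimeSpace τ y))
              ≤ ENNReal.ofReal (2 * coordEnergyDensity U f (E4.ofTimeSpace τ y) +
                  2 * coordEnergyDensity U (f - g) (E4.ofTimeSpace τ y)) :=
                ENNReal.ofReal_le_ofReal hle
            _ = 2 * ENNReal.ofReal (coordEnergyDensity U f (E4.ofTimeSpace τ y)) +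
                  2 * ENNReal.ofReal (coordEnergyDensity U (f - g) (E4.ofTimeSpace τ y)) := by
                rw [ENNReal.ofReal_add (by positivity) (by positivity),
                  ENNReal.ofReal_mul zero_le_two, ENNReal.ofReal_mul zero_le_two,
                  ENNReal.ofReal_ofNat]
        · have hyS : y ∉ {y : E3 | E4.ofTimeSpace τ y ∈ U} := hy
          rw [Set.indicator_of_notMem hyS]
          exact zero_le
    _ = 2 * (∫⁻ y in Metric.closedBall (0 : E3) R, {y : E3 | E4.ofTimeSpace τ y ∈ U}.indicator
            (fun y ↦ ENNReal.ofReal (coordEnergyDensity U f (E4.ofTimeSpace τ y))) y) +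
          2 * (∫⁻ y in Metric.closedBall (0 : E3) R, {y : E3 | E4.ofTimeSpace τ y ∈ U}.indicator
            (fun y ↦ ENNReal.ofReal (coordEnergyDensity U (f - g) (E4.ofTimeSpace τ y))) y) := by
        rw [lintegral_add_left ((measurable_sliceIntegrand U f τ).const_mul 2),
          lintegral_const_mul' _ _ ENNReal.ofNat_ne_top,
          lintegral_const_mul' _ _ ENNReal.ofNat_ne_top]

end General

/-! ### The two inputs of the localised solutions (named facts) -/

/-- **(A) The Cauchy problem and the energy estimate for `□_g` on the Kerr exterior** (named
fact; the well-posedness input of Sbierski's Thm. 2.1). Sbierski, Anal. PDE 8 (2015), proof of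
Thm. 2.1: with `v` "the solution of the following initial value problem: `□v = 0`,
`v|_{Σ₀} = ũ|_{Σ₀}`, `n_{Σ₀} v|_{Σ₀} = n_{Σ₀} ũ|_{Σ₀}`. Here, we make use of the fact that the
Lorentzian manifold `(M, g)` is globally hyperbolic and thus allows for a well-posed initial value
problem for the wave equation. Moreover, [...] we have an energy estimate of the form
`∫_{Σ_τ} J^N(u)·n_{Σ_τ} vol ≤ C(T, N, {Σ_τ}) (∫_{Σ₀} J^N(u)·n_{Σ₀} vol + ‖□u‖²_{L²(R_{[0,T]})})`
for all `0 ≤ τ ≤ T` at our disposal (see for example [Taylor], chapter 2.8). Thus, we obtain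
`E^N_τ(v − ũ) ≤ C(T, N, Σ_τ) · ‖□ũ‖²_{L²(R_{[0,T]})}` for all `0 ≤ τ ≤ T`", applied, for
Thm. 7.4, on the domain of outer communications of Kerr, `0 ≤ a ≤ m`, `m ≠ 0`, foliated by
`t* = v₊ − r` with `N = −(dt*)♯` (§7A), whose region `{t* ≥ 0}` lies in the future Cauchy
development of `Σ₀ = {t* = 0}` (parent file, "Solutions"). The elided clause of the quotation is
"the condition [displayed in the statement of Thm. 2.1] ensures that", that condition being the
uniformity hypothesis `1/|∇t| ≤ C`, `g(N, N) ≤ −c < 0`, `−g(N, n_{Σ_τ}) ≤ C`, `|∇N(n, n)|,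
|∇N(n, e_i)|, |∇N(e_i, e_j)| ≤ C` on `R_{[0,T]} ∩ J⁺(𝒩 ∩ Σ₀)`; the printed global estimate is
conditional on it, and it holds for the foliation `t*` and the field `N = −(dt*)♯` used here
(Sbierski checks it for the same choice on Schwarzschild, arXiv p. 21: "for our choice of time
function and vector field `N` the condition is satisfied", the estimate being derived "by an
application of Stokes' theorem to `J^N(u) ⌟ vol_g`, followed by Gronwall's inequality"; on
relatively compact regions it is automatic, arXiv Remark 2 following Thm. 2.1). Existence and
uniqueness of the smooth solution for smooth compactly supported data on a Cauchy hypersurface of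
a globally hyperbolic manifold is Bär–Ginoux–Pfäffle 2007, Ch. 3, Sect. 2, Thm. 2.9 (arXiv
version). **Vendored form** (rendering of the module docstring: `C^∞` functions on the ingoing
Kerr–Schild chart `Kerr.exterior M a`, coordinate energies through the leaves `{t* = τ}`,
`‖□ũ‖²_{L²(R_{[0,T]})} = slabSqNorm`, comparability constants absorbed): for `0 < M`, `0 ≤ a ≤ M`
there is `K : ℝ → [0, ∞]` with `K(T) < ∞` for all `T` such that for every `C^∞` function `u` on
the chart vanishing outside a compact subset of the chart there is a `C^∞` function `ψ` on the
chart solving `□_{g_{M,a}} ψ = 0` on `{t* > 0}`, having the Cauchy data of `u` on `{t* = 0}`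
(`ψ = u` and `dψ = du` at every point of the chart with `t* = 0`), and with
`sliceEnergy (ψ − u) τ ≤ K(T) · slabSqNorm (□u) T` for all `0 ≤ τ ≤ T`. Derived from the canonical
named fact `KerrSchild.waveCauchyProblem` (Cauchy problem on generalised Kerr–Schild backgrounds)
in `TrappingDerivativeLossEnergy.lean`, `KerrWaveCauchyEnergyEstimate.of_waveCauchyProblem` (the
energy-estimate half is proved there; what remains named is the existence theory for `□_g`).
[cite: Sbierski2015, §2 proof of Thm. 2.1 (energy estimate) with Thm. 7.4; BarGinouxPfaffle2007 Ch. 3 Sect. 2 Thm. 2.9] -/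
def KerrWaveCauchyEnergyEstimate : Prop :=
  ∀ [Kerr.Facts] [Kerr.SliceFacts] (M a : ℝ), 0 < M → 0 ≤ a → a ≤ M →
    ∃ K : ℝ → ℝ≥0∞, (∀ T, K T < ⊤) ∧
      ∀ u : Kerr.exterior M a → ℝ, ContMDiff 𝓘(ℝ, E4) 𝓘(ℝ, ℝ) ∞ u →
        (∃ S : Set (Kerr.exterior M a), IsCompact S ∧ ∀ x, x ∉ S → u x = 0) →
        ∃ ψ : Kerr.exterior M a → ℝ,
          ContMDiff 𝓘(ℝ, E4) 𝓘(ℝ, ℝ) ∞ ψ ∧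
          (∀ x : Kerr.exterior M a, 0 < (x : E4) 0 →
            (Kerr.smoothMetric M a (Kerr.rPlus M a)).toPseudoRiemannianMetric.dalembertian ψ x
              = 0) ∧
          (∀ x : Kerr.exterior M a, (x : E4) 0 = 0 →
            ψ x = u x ∧ mfderiv 𝓘(ℝ, E4) 𝓘(ℝ, ℝ) ψ x = mfderiv 𝓘(ℝ, E4) 𝓘(ℝ, ℝ) u x) ∧
          ∀ T τ : ℝ, 0 ≤ τ → τ ≤ T →
            sliceEnergy (Kerr.exterior M a) (ψ - u) τ ≤
              K T * slabSqNorm (Kerr.exterior M a) (fun x ↦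
                (Kerr.smoothMetric M a (Kerr.rPlus M a)).toPseudoRiemannianMetric.dalembertian u x)
                T

/-- **(B) Sbierski's Gaussian beams along the trapped null geodesics of Kerr** (named fact; the
geometric-optics input of Thm. 5.1/7.4). Sbierski, Anal. PDE 8 (2015): (i) proof of Thm. 2.1 and
§3 (arXiv §2.1–2.2): for a null geodesic `γ` and a neighbourhood `𝒩` of `γ` there are Gaussian
beams `u_λ = a_𝒩 e^{iλφ} ∈ C^∞(M)` (real parts allowed) with `‖□u_λ‖_{L²(R_{[0,T]})} ≤ C(T)`,
`E^N_0(u_λ) → ∞` (`λ → ∞`) and `supp u_λ ⊆ 𝒩`, `𝒩 ∩ R_{[0,T]}` relatively compact, so that the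
normalised beam `ũ_λ = u_λ √E / √(E^N_0(u_λ))` has `E^N_0(ũ_λ) = E` and
`‖□ũ_λ‖_{L²(R_{[0,T]})} → 0`; (ii) the main theorem of Part I (arXiv Thm. 7, §2.3; journal §4):
"For any `T > 0` with `Im(γ) ∩ Σ_T ≠ ∅` and for any `μ > 0` there exists a neighbourhood `𝒩₀` of
`γ` and a `λ₀ > 0` such that any Gaussian beam `ũ_{λ,𝒩}` along `γ` [...] with parameters
`λ ≥ λ₀` and `𝒩₀`, and with initial `N`-energy equal to `−g(N, γ̇)|_{γ(0)}` satisfies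
`|E^N_τ(ũ_{λ,𝒩₀}) − [−g(N, γ̇)|_{Im(γ) ∩ Σ_τ}]| < μ` for all `0 ≤ τ ≤ T`"; (iii) §7A (arXiv
§3.2.1): in the domain of outer communications of Kerr, `0 ≤ a ≤ m`, `m ≠ 0`, with `t* = v₊ − r`,
`N = −(dt*)♯`, "there are trapped null geodesics [...] whose energy stays bounded away from zero
and infinity", namely `γ_{r₀}` on `{r = r₀}`, `r₀ ∈ [r_δ, r_ρ]` (roots of `r(r − 3m)² − 4a²m`),
with `−(N, γ̇) = ṫ`. **Vendored form** (rendering of the module docstring; `γ = γ_{r₀}` with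
`r₀ = r_ρ ≥ 3M > r₊`, contained in the open cylinder `{‖y‖ < R}` for `R ≥ R₀(M, a)` since
`‖y‖² ≤ r² + a²` in Kerr–Schild coordinates; `𝒩₀` chosen inside that cylinder and away from
`{r = r₊}`; the beam cut off smoothly in `t*` outside `[−1, T + 1]`, which changes neither its
data on `Σ₀`, nor `□` on `R_{[0,T]}`, nor its energies for `0 ≤ τ ≤ T`; `μ = ṫ*/2`; coordinate
energies with comparability constants absorbed into `c`, `C`): for `0 < M`, `0 ≤ a ≤ M` there is
`R₀` such that for every `R ≥ R₀` there are `c > 0` and `C` such that for every `T ≥ 0` and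
every `ε > 0` some `C^∞` function `u` on the chart `Kerr.exterior M a`, vanishing outside a
compact subset of the chart, with `u = 0` and `du = 0` at the points of `{t* = 0}` with `‖y‖ > R`,
has `sliceEnergy u 0 ≤ C`, `slabSqNorm (□_{g_{M,a}} u) T ≤ ε`, and `c ≤ localSliceEnergy u τ R`
for all `0 ≤ τ ≤ T`. Derived from the literal beam fact `SbierskiKerrTrappedGeodesicBeams` (same
source, Sbierski's own `N`-energy) in `TrappingDerivativeLossBeams.lean`,
`SbierskiKerrGaussianBeams.of_trappedGeodesicBeams`; the Gaussian-beam construction itself is not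
in Mathlib/Literature. [cite: Sbierski2015, proof of Thm. 2.1 with arXiv Thm. 7 (§2.3) and §7A] -/
def SbierskiKerrGaussianBeams : Prop :=
  ∀ [Kerr.Facts] [Kerr.SliceFacts] (M a : ℝ), 0 < M → 0 ≤ a → a ≤ M →
    ∃ R₀ : ℝ, ∀ R : ℝ, R₀ ≤ R →
      ∃ c C : ℝ, 0 < c ∧ ∀ T : ℝ, 0 ≤ T → ∀ ε : ℝ, 0 < ε →
        ∃ u : Kerr.exterior M a → ℝ,
          ContMDiff 𝓘(ℝ, E4) 𝓘(ℝ, ℝ) ∞ u ∧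
          (∃ S : Set (Kerr.exterior M a), IsCompact S ∧ ∀ x, x ∉ S → u x = 0) ∧
          (∀ x : Kerr.exterior M a, (x : E4) 0 = 0 → R < E4.spatialNorm (x : E4) →
            u x = 0 ∧ mfderiv 𝓘(ℝ, E4) 𝓘(ℝ, ℝ) u x = 0) ∧
          sliceEnergy (Kerr.exterior M a) u 0 ≤ ENNReal.ofReal C ∧
          slabSqNorm (Kerr.exterior M a) (fun x ↦
              (Kerr.smoothMetric M a (Kerr.rPlus M a)).toPseudoRiemannianMetric.dalembertian u x)
            T ≤ ENNReal.ofReal ε ∧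
          ∀ τ : ℝ, 0 ≤ τ → τ ≤ T →
            ENNReal.ofReal c ≤ localSliceEnergy (Kerr.exterior M a) u τ R

/-! ### Thm. 2.1's approximation argument: the localised solutions from (A) and (B) -/

/-- **Sbierski's localised solutions from the Cauchy problem and the Gaussian beams** (the proof
of Thm. 2.1 / Thm. 5.1 in the rendering): (A) `KerrWaveCauchyEnergyEstimate` and (B)
`SbierskiKerrGaussianBeams` imply `SbierskiKerrLocalisedSolutions`. Proof as printed (Anal. PDE 8
(2015), proof of Thm. 2.1, and Thm. 5.1 = arXiv Thm. 8: "This follows easily from Theorem 2.1,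
[the main theorem] and the triangle inequality for the square root of the `N`-energy"): given
`R ≥ R₀` take `c_B > 0`, `C` from (B) and `K` from (A), and put `c := c_B / 4`; given `T ≥ 0`
choose `ε > 0` with `K(T) ε ≤ c_B / 4`, the beam `u` of (B) for `(T, ε)` and the solution `ψ` of
(A) with the data of `u`. Then `ψ` is `C^∞`, solves `□_g ψ = 0` on `{t* > 0}`, its data vanish
with those of `u` outside the ball, `sliceEnergy ψ 0 = sliceEnergy u 0 ≤ C` (same data), and for
`0 ≤ τ ≤ T`: `c_B ≤ E_loc(u) ≤ 2 E_loc(ψ) + 2 E(ψ − u) ≤ 2 E_loc(ψ) + 2 K(T) ε ≤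
2 E_loc(ψ) + c_B / 2`, whence `E_loc(ψ) ≥ c_B / 4 = c`. [cite: Sbierski2015, Thm. 2.1 (proof) and Thm. 5.1] -/
theorem SbierskiKerrLocalisedSolutions.of_inputs (hA : KerrWaveCauchyEnergyEstimate)
    (hB : SbierskiKerrGaussianBeams) : SbierskiKerrLocalisedSolutions := by
  intro _ _ M a hM ha₀ haM
  obtain ⟨R₀, hR⟩ := hB M a hM ha₀ haM
  obtain ⟨K, hKfin, hsolve⟩ := hA M a hM ha₀ haM
  refine ⟨R₀, fun R hRR ↦ ?_⟩
  obtain ⟨cB, C, hcB, hbeam⟩ := hR R hRR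
  refine ⟨cB / 4, C, by positivity, fun T hT ↦ ?_⟩
  -- ### choice of `ε` with `K(T) · ε ≤ c_B / 4`
  set k : ℝ := (K T).toReal with hk
  have hk0 : 0 ≤ k := ENNReal.toReal_nonneg
  set ε : ℝ := cB / (4 * (k + 1)) with hε_def
  have hε : 0 < ε := by positivity
  have hKε : K T * ENNReal.ofReal ε ≤ ENNReal.ofReal (cB / 4) := by
    have hKT : K T = ENNReal.ofReal k := (ENNReal.ofReal_toReal (hKfin T).ne).symm
    rw [hKT, ← ENNReal.ofReal_mul hk0]
    refine ENNReal.ofReal_le_ofReal ?_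
    rw [hε_def, mul_div_assoc']
    rw [div_le_div_iff₀ (by positivity) (by positivity)]
    nlinarith
  -- ### the beam and the solution with its data
  obtain ⟨u, hu, hsupp, hdata, hE₀, hbox, hloc⟩ := hbeam T hT ε hε
  obtain ⟨ψ, hψ, hwave, hagree, hest⟩ := hsolve u hu hsupp
  have hinf : (∞ : ℕ∞ω) ≠ 0 := by simp
  refine ⟨ψ, hψ, hwave, ?_, ?_, ?_⟩
  · -- data of `ψ` vanish outside the ball, with those of `u`
    intro x hx0 hxR
    obtain ⟨h1, h2⟩ := hagree x hx0
    obtain ⟨h3, h4⟩ := hdata x hx0 hxR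
    exact ⟨h1.trans h3, h2.trans h4⟩
  · -- same data, same initial energy
    rw [sliceEnergy_congr_of_mfderiv_eq hinf hψ hu 0 fun x hx ↦ (hagree x hx).2]
    exact hE₀
  · -- lower bound for the local energy of `ψ` on `[0, T]`
    intro τ hτ₀ hτT
    have hsplit := localSliceEnergy_le_two_mul_add (U := Kerr.exterior M a) hinf hψ hu τ R
    have hdiff : localSliceEnergy (Kerr.exterior M a) (ψ - u) τ R ≤ ENNReal.ofReal (cB / 4) :=
      calc localSliceEnergy (Kerr.exterior M a) (ψ - u) τ R
          ≤ sliceEnergy (Kerr.exterior M a) (ψ - u) τ := localSliceEnergy_le_sliceEnergy _ _ _ _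
        _ ≤ K T * slabSqNorm (Kerr.exterior M a) (fun x ↦
              (Kerr.smoothMetric M a (Kerr.rPlus M a)).toPseudoRiemannianMetric.dalembertian u x)
              T := hest T τ hτ₀ hτT
        _ ≤ K T * ENNReal.ofReal ε := by gcongr
        _ ≤ ENNReal.ofReal (cB / 4) := hKε
    -- `c_B ≤ 2 E_loc(ψ) + c_B / 2`
    have hmain : ENNReal.ofReal cB ≤
        2 * localSliceEnergy (Kerr.exterior M a) ψ τ R + ENNReal.ofReal (cB / 2) :=
      calc ENNReal.ofReal cB ≤ localSliceEnergy (Kerr.exterior M a) u τ R := hloc τ hτ₀ hτT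
        _ ≤ 2 * localSliceEnergy (Kerr.exterior M a) ψ τ R +
              2 * localSliceEnergy (Kerr.exterior M a) (ψ - u) τ R := hsplit
        _ ≤ 2 * localSliceEnergy (Kerr.exterior M a) ψ τ R + 2 * ENNReal.ofReal (cB / 4) := by
            gcongr
        _ = 2 * localSliceEnergy (Kerr.exterior M a) ψ τ R + ENNReal.ofReal (cB / 2) := by
            rw [← ENNReal.ofReal_ofNat 2, ← ENNReal.ofReal_mul zero_le_two]
            congr 2
            ring
    -- conclude `E_loc(ψ) ≥ c_B / 4`
    by_contra hlt
    rw [not_le] at hlt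
    have h2lt : 2 * localSliceEnergy (Kerr.exterior M a) ψ τ R < 2 * ENNReal.ofReal (cB / 4) :=
      ENNReal.mul_lt_mul_right two_ne_zero ENNReal.ofNat_ne_top hlt
    have h3 : 2 * localSliceEnergy (Kerr.exterior M a) ψ τ R + ENNReal.ofReal (cB / 2) <
        2 * ENNReal.ofReal (cB / 4) + ENNReal.ofReal (cB / 2) :=
      ENNReal.add_lt_add_right ENNReal.ofReal_ne_top h2lt
    have h4 : 2 * ENNReal.ofReal (cB / 4) + ENNReal.ofReal (cB / 2) = ENNReal.ofReal cB := by
      rw [← ENNReal.ofReal_ofNat 2, ← ENNReal.ofReal_mul zero_le_two,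
        ← ENNReal.ofReal_add (by positivity) (by positivity)]
      congr 1
      ring
    rw [h4] at h3
    exact absurd (hmain.trans_lt h3) (lt_irrefl _)

/-- **The barrier from its two inputs**: (A) and (B) give the data-localised trapping
obstruction `SbierskiTrappingObstruction`, through `SbierskiKerrLocalisedSolutions.of_inputs`
and the proved LED criterion `SbierskiTrappingObstruction.of_localisedSolutions` (Thm. 5.5).
This is the whole printed proof of Thm. 7.4 above the two named facts. [cite: Sbierski2015, Thm. 7.4 with Thm. 5.5 and Thm. 2.1] -/
theorem SbierskiTrappingObstruction.of_inputs (hA : KerrWaveCauchyEnergyEstimate)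
    (hB : SbierskiKerrGaussianBeams) : SbierskiTrappingObstruction :=
  SbierskiTrappingObstruction.of_localisedSolutions
    (SbierskiKerrLocalisedSolutions.of_inputs hA hB)

/-- **Sbierski's Kerr trapping theorem (print-literal form) from its two inputs** (A), (B), via
the data-localised obstruction and `SbierskiTrappingObstruction.literal`.
[cite: Sbierski2015, Thm. 7.4] -/
theorem SbierskiKerrTrappingLED.of_inputs (hA : KerrWaveCauchyEnergyEstimate)
    (hB : SbierskiKerrGaussianBeams) : SbierskiKerrTrappingLED :=
  SbierskiTrappingObstruction.literal (SbierskiTrappingObstruction.of_inputs hA hB)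

end Literature.Barriers.FinalStateConjecture

end
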